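/-
Copyright (c) 2026 the pub-hodgecm-mathlib formalisation cell (harness21).  Prover seat hodgecm-mathlib-K2Liu-p10 (g5), Track B «K2-LIT»,
#184♮ = hLiu418 = `stmt-HodgeConjecture-24832`; (σ) endgame organ, socket σ-7a: the slice geometry behind `hSiegS` for `B := sectionB` (null cone, pins, frame, Levi block).
-/
import Summits.HodgeConjecture.HodgeConjecture.Theorems.K2LiuKRFrameInstanceDefs               -- ★ σ-2 p860974 (`thetaLoc`, `twistLoc`)
import Summits.HodgeConjecture.HodgeConjecture.Theorems.K2LiuKRFrameSliceNullCone               -- ★ S-2c (e) p860938 (`hermForm_rows_slice_eq_zero`)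
import Summits.HodgeConjecture.HodgeConjecture.Theorems.K2LiuA7ValueUnipotentPinsHerm           -- ★ K2Liu-p02 p860905 (`qHerm`, `qHerm_eq_zero_iff`; brings `gramLoc`, `bmat`)
import Summits.HodgeConjecture.HodgeConjecture.Theorems.K2LiuA7ValueUnipotentPinsN              -- ★ K2Liu-p02 p860969 (`hMat`, `tMat`, `nDeltaLoc`, `isUnit_det_gramS_gramR`)
import Summits.HodgeConjecture.HodgeConjecture.Theorems.K2LiuUnipDeltaLocalCoordinates           -- ★ (`skew_blkB_of_mem_unipDeltaLocal`, `eq_nElem_of_mem_unipDeltaLocal`)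
import Summits.HodgeConjecture.HodgeConjecture.Theorems.K2LiuWittFrameLocalRing                  -- ★ K2Liu-p07 p860951 (`exists_wittFrame_localRing`)
import Literature.NumberTheory.GelbartRogawski1991.LocalDoubledTwistedSectionUnipotentWord         -- ★ `nElem_congr`
import Literature.NumberTheory.Automorphic.UnitaryGroupSymplecticCarriers                        -- ★ `localForm_eq_map`
import HarnessLib

/-!
# Crux `HLiu418`, (σ) endgame, σ-7a: THE SLICE GEOMETRY OF THE KUDLA–RALLIS SECTION `B := sectionB` (null cone, pins, Witt frame, Levi block)

Cell `hodgecm-mathlib`, crux item hLiu418 = `stmt-HodgeConjecture-24832`, route of record `HCCMUnconditional`; squad K2 ∕ K2Liu, prover K2Liu-p10 (g5).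
THEOREMS ONLY (no definition, no instance, no notation, no named fact, no `sorry`); lane `--supports stmt-HodgeConjecture-24832 --as helper`.
The four instance letters that σ-7b (`K2LiuA7ValueSocketSmallSide`, the socket `hSiegS` for `B := sectionB`, ★ σ-2) consumes, all at the K2Lit CM datum `(L, e, dV, dW)` with
`e : Fin N × Fin M ≃ Fin 2` (`H_v = U(2,2)`), partner `V′ = (L³, diag dV′)`:

* §1 `gramLoc_eq_hermForm` — p02's Gram matrix `gramLoc b` (★ `K2LiuA7ValueUnipotentPins`) IS the row pairing `h_{J′}(X i, X j)` of ★ S-0a's coordinate matrix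
  `X = matOfVec b` (same `epsV`), `J′ = (J_{V′})_v`.
* §2 **`qHerm_thetaLoc_symm_slice_eq_zero`** (`hq0`): the integrated slice `θ_v⁻¹((0 ⊔ 0) ⊔ t)` of the frame ★ σ-2 `thetaLoc P` lies in the null cone `{qHerm = 0}`
  for every Witt frame `P` (`(P^σ)ᵀ W P = J′`, `W₀₀ = 0`) — ★ S-2c (e) `hermForm_rows_slice_eq_zero` + ★ `qHerm_eq_zero_iff`.
* §3 **`exists_sliceFrame`**: at a non-split `v` such a frame EXISTS (★ K2Liu-p07 `exists_wittFrame_localRing` + ★ `localForm_eq_map`: `J′ = ι(diag dV′)`).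
* §4 **`exists_nDeltaLoc_eq_of_mem_unipDeltaLocal`**: p02's pins `η ↦ nΔ η` (★ `nDeltaLoc`) EXHAUST `N_Δ(L⁺_v)` at `n = 2` (every skew-hermitian `2 × 2` table is `h(η)`,
  `exists_hMat_eq`; ★ `eq_nElem_of_mem_unipDeltaLocal`, ★ `nElem_congr`) — so V8e's per-pin law `hN` gives invariance under all of `N_Δ`.
* §5 `val_inv_blkDGL_leviDeltaLoc`, **`val_inv_leviBlkDHom`**: the `hG` letter of ★ S-2c (b) `krFrameTw_leviAct_inv_slice_mulVec` for `G := leviBlkDHom a` (★ I-2), `D := D(a)` (★ I-0 `blkDGL`).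

HONEST LABEL: HC_CM is proved only modulo the 7 printed citations (2 remaining named inputs: hLiu418 = stmt-HodgeConjecture-24832, h413 = stmt-HodgeConjecture-24833)
until rung 0 closes; helper, closes no item.
References: [KudlaRallis1994] §1–§2; [Kudla1994] §3 Thm. 3.1; [Weil1964] n° 32; [Scharlau1985HermitianForms] Ch. 7 §6.
-/

set_option autoImplicit false
set_option linter.dupNamespace false -- the mandated namespace repeats `HodgeConjecture.HodgeConjecture`

noncomputable section

open scoped Matrix Kronecker
open NumberField IsDedekindDomain Matrix
open Literature.NumberTheory.Automorphic Literature.NumberTheory.Automorphic.UnitaryGroup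
open Literature.NumberTheory.Automorphic.UnitaryGroup.QuadraticCoordinates
open Literature.NumberTheory.GelbartRogawski1991 Literature.NumberTheory.GelbartRogawski1991.GRConstruction
open Literature.NumberTheory.GelbartRogawski1991.UnitaryDualPair
open Literature.NumberTheory.GelbartRogawski1991.UnitaryDualPair.LocalSplitting
open Literature.NumberTheory.GelbartRogawski1991.AdaptedBlocks
open Literature.NumberTheory.K2Lit.SiegelDoubled Literature.NumberTheory.K2Lit.LocalSiegelDoubled
open Summit.HodgeConjecture.HodgeConjecture.Cruxes.HLiu418.K2LiuDeltaModelRealFrame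
open Summit.HodgeConjecture.HodgeConjecture.Cruxes.HLiu418.K2LiuKRFrameDefs
open Summit.HodgeConjecture.HodgeConjecture.Cruxes.HLiu418.K2LiuKRFrameSliceNullCone
open Summit.HodgeConjecture.HodgeConjecture.Cruxes.HLiu418.K2LiuKRFrameInstanceDefs
open Summit.HodgeConjecture.HodgeConjecture.Cruxes.HLiu418.K2LiuA7ValueInstanceDefs
open Summit.HodgeConjecture.HodgeConjecture.Cruxes.HLiu418.K2LiuA7ValueUnipotentPins
open Summit.HodgeConjecture.HodgeConjecture.Cruxes.HLiu418.K2LiuA7ValueUnipotentPinsHerm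
open Summit.HodgeConjecture.HodgeConjecture.Cruxes.HLiu418.K2LiuA7ValueUnipotentPinsN
open Summit.HodgeConjecture.HodgeConjecture.Cruxes.HLiu418.K2LiuUnipDeltaLocalCoordinates
open Summit.HodgeConjecture.HodgeConjecture.Cruxes.HLiu418.K2LiuWittFrameLocalRing

namespace Summit.HodgeConjecture.HodgeConjecture.Cruxes.HLiu418.K2LiuA7ValueSliceGeometry

/-! ## §1 The Gram matrix is the row pairing of the coordinate matrix -/

section Gram

variable (L : Type) [Field L] [NumberField L] [IsCMField L]
variable {N M n : ℕ} (e : Fin N × Fin M ≃ Fin n)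
variable {M₂ M' n' : ℕ} (eW : Fin M × Fin M₂ ≃ Fin M') (e' : Fin N × Fin M' ≃ Fin n') (dV' : Fin M₂ → L)
variable (v : HeightOneSpectrum (𝓞 (Fp L)))

/-- **`gramLoc b i j = h_{J′}(bmat b i, bmat b j)`** (`J′ = (J_{V′})_v`, `σ = conjLocal`; `bmat b i k = b (epsV (i,k))`). [cite: Kudla1994, §3 Thm. 3.1] -/
theorem gramLoc_eq_hermForm (b : Fin n' → LocalRing L v) (i j : Fin n) :
    gramLoc L e eW e' dV' v b i j =
      hermForm (conjLocal L (IsCMField.complexConj L) v : LocalRing L v →+* LocalRing L v) ((adelicForm L M₂ (Matrix.diagonal dV')).map (adeleToLocal L v))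
        (bmat L e eW e' v b i) (bmat L e eW e' v b j) := by
  rw [hermForm_apply, gramLoc, Matrix.mul_apply]
  simp only [Matrix.mul_apply, Matrix.transpose_apply, Matrix.map_apply, dotProduct, Matrix.mulVec, Function.comp_apply, Finset.sum_mul, Finset.mul_sum]
  rw [Finset.sum_comm]
  exact Finset.sum_congr rfl fun k _ => Finset.sum_congr rfl fun l _ => by ring

end Gram

/-! ## §2 The integrated slice lies in the null cone (`hq0`) -/

section NullCone

variable (L : Type) [Field L] [NumberField L] [IsCMField L] [Algebra.IsQuadraticExtension (Fp L) L]
  {δ : L} (hcδ : IsCMField.complexConj L δ = -δ) (hδ : δ ≠ 0)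
variable {N M : ℕ} (e : Fin N × Fin M ≃ Fin 2)
  (dV : Fin N → L) (hdV : ∀ i, IsCMField.complexConj L (dV i) = dV i) (hdV0 : ∀ i, dV i ≠ 0)
  (dW : Fin M → L) (hdW : ∀ i, IsCMField.complexConj L (dW i) = dW i) (hdW0 : ∀ i, dW i ≠ 0)
variable {M' n' : ℕ} (eW : Fin M × Fin 3 ≃ Fin M') (e' : Fin N × Fin M' ≃ Fin n')
  (dV' : Fin 3 → L) (hdV' : ∀ k, IsCMField.complexConj L (dV' k) = dV' k)
variable (v : HeightOneSpectrum (𝓞 (Fp L)))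

include hdV' in
/-- **`hq0`: THE INTEGRATED SLICE IS ISOTROPIC** — for a Witt frame `P` of `V′_v` (`(P^σ)ᵀ · W · P = J′_v`, `W₀₀ = 0`) every slice point `θ_v⁻¹((0 ⊔ 0) ⊔ t)` of the twisted
Kudla–Rallis frame `θ_v = thetaLoc P` (built on the `(hcδ, hδ)` quadratic coordinates of ★ σ-2, here `δ = imagUnit`) has `qHerm = 0` (all row pairings vanish, ★ S-2c (e); ★ `qHerm_eq_zero_iff`).
[cite: KudlaRallis1994, §1] [cite: Kudla1994, §3 Thm. 3.1] -/
theorem qHerm_thetaLoc_symm_slice_eq_zero (P : GL (Fin 3) (LocalRing L v)) (W : Matrix (Fin 3) (Fin 3) (LocalRing L v)) (hW : W 0 0 = 0)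
    (hPJ : (P.val.map (conjLocal L (IsCMField.complexConj L) v : LocalRing L v →+* LocalRing L v))ᵀ * W * P.val =
      (adelicForm L 3 (Matrix.diagonal dV')).map (adeleToLocal L v))
    (t : Fin (2 + 2) → v.adicCompletion (Fp L)) :
    qHerm L (complexConj_imagUnit L) (imagUnit_ne_zero L) e eW e' dV' v
      ((thetaLoc L e dV hdV hdV0 dW hdW hdW0 eW e' v P).symm
        (Sum.elim (Sum.elim (0 : Fin (2 + 2) → v.adicCompletion (Fp L)) (0 : Fin (2 + 2) → v.adicCompletion (Fp L))) t)) = 0 := by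
  rw [qHerm_eq_zero_iff L (complexConj_imagUnit L) (imagUnit_ne_zero L) e eW e' dV' hdV' v]
  refine Matrix.ext fun i j => ?_
  rw [gramLoc_eq_hermForm, Matrix.zero_apply]
  exact hermForm_rows_slice_eq_zero (Fp L) L (IsCMField.complexConj L) (complexConj_imagUnit L) (imagUnit_ne_zero L) v 2 (epsV e eW e') P
    (twistLoc L e dV hdV hdV0 dW hdW hdW0 v) W _ hW hPJ t i j

end NullCone

/-! ## §3 A slice frame exists at a non-split place -/

section Frame

variable (L : Type) [Field L] [NumberField L] [IsCMField L] [Algebra.IsQuadraticExtension (Fp L) L]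
  (dV' : Fin 3 → L) (hdV' : ∀ k, IsCMField.complexConj L (dV' k) = dV' k) (hdV'0 : ∀ k, dV' k ≠ 0)
  (v : HeightOneSpectrum (𝓞 (Fp L)))

include hdV' hdV'0 in
/-- **A WITT FRAME OF `V′_v` IN THE `hPJ` SHAPE OF §2** at a non-split `v` (`c • w₀ = w₀`): `∃ P W, W₀₀ = 0 ∧ (P^σ)ᵀ W P = J′_v` — ★ K2Liu-p07 `exists_wittFrame_localRing`
with `d k := (dV′ k)_v` (`dV′ k ∈ L⁺`, `≠ 0`) and `J′_v = ι(diag dV′)` (★ `localForm_eq_map`). [cite: Scharlau1985HermitianForms, Ch. 7 §6] [cite: KudlaRallis1994, §1] -/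
theorem exists_sliceFrame (hc : IsCMField.complexConj L ≠ 1) (w₀ : PlacesOver L v) (hw₀ : IsCMField.complexConj L • w₀.1 = w₀.1) :
    ∃ (P : GL (Fin 3) (LocalRing L v)) (W : Matrix (Fin 3) (Fin 3) (LocalRing L v)), W 0 0 = 0 ∧
      (P.val.map (conjLocal L (IsCMField.complexConj L) v : LocalRing L v →+* LocalRing L v))ᵀ * W * P.val =
        (adelicForm L 3 (Matrix.diagonal dV')).map (adeleToLocal L v) := by
  -- the real diagonal `d₀ : Fin 3 → L⁺` under `dV′` and its image `d` in `L⁺_v`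
  let d₀ : Fin 3 → Fp L := fun k => ⟨dV' k, (IsCMField.complexConj_eq_self_iff (K := L) _).1 (hdV' k)⟩
  let d : Fin 3 → v.adicCompletion (Fp L) := fun k => algebraMap (Fp L) (v.adicCompletion (Fp L)) (d₀ k)
  have hd0 : ∀ k, d k ≠ 0 := fun k => by
    have h0 : d₀ k ≠ 0 := fun h => hdV'0 k (by simpa [d₀] using congrArg Subtype.val h)
    exact (map_ne_zero_iff _ (algebraMap (Fp L) (v.adicCompletion (Fp L))).injective).2 h0
  obtain ⟨P, hP⟩ := exists_wittFrame_localRing (IsCMField.complexConj L) hc (complexConj_imagUnit L) (imagUnit_ne_zero L) (imagUnit_mul_self L) v w₀ hw₀ d hd0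
  refine ⟨P, _, by rw [Matrix.map_apply]; simp, hP.trans ?_⟩
  -- `ι(diag d) = J′_v`
  have hJ : Matrix.diagonal dV' = (Matrix.diagonal d₀).map (algebraMap (Fp L) L) := by
    rw [Matrix.diagonal_map (map_zero _)]
    rfl
  rw [localForm_eq_map L 3 v (Matrix.diagonal d₀) hJ]
  congr 1
  rw [Matrix.diagonal_map (map_zero _)]

end Frame

/-! ## §4 The pins exhaust `N_Δ(L⁺_v)` (`n = 2`) -/

section Pins

variable (L : Type) [Field L] [NumberField L] [IsCMField L] [Algebra.IsQuadraticExtension (Fp L) L]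
variable {N M : ℕ} (e : Fin N × Fin M ≃ Fin 2)
  (dV : Fin N → L) (hdV : ∀ i, IsCMField.complexConj L (dV i) = dV i) (hdV0 : ∀ i, dV i ≠ 0)
  (dW : Fin M → L) (hdW : ∀ i, IsCMField.complexConj L (dW i) = dW i) (hdW0 : ∀ i, dW i ≠ 0)
variable (v : HeightOneSpectrum (𝓞 (Fp L)))

/-- **every skew-hermitian `2 × 2` table over `L ⊗ L⁺_v` is `h(η)`** for `η := (−im h₀₀, −im h₁₁, −2 im h₀₁, −2 re h₀₁)` (quadratic coordinates `δ = imagUnit`).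
[cite: Kudla1994, §3 Thm. 3.1] [cite: Weil1964, n° 32] -/
theorem exists_hMat_eq (h : Matrix (Fin 2) (Fin 2) (LocalRing L v))
    (hh : (h.map (conjLocal L (IsCMField.complexConj L) v))ᵀ = -h) :
    ∃ η : Fin 4 → v.adicCompletion (Fp L), hMat L v η = h := by
  set Ψ := quadraticLocalEquiv L v (IsCMField.complexConj L) (complexConj_imagUnit L) (imagUnit_ne_zero L) with hΨ
  -- coordinates `z = Ψ (R z, I z)`
  set R : LocalRing L v → v.adicCompletion (Fp L) := fun z => re Ψ.toLinearEquiv.toAddEquiv z with hR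
  set I : LocalRing L v → v.adicCompletion (Fp L) := fun z => im Ψ.toLinearEquiv.toAddEquiv z with hI
  have hcoord : ∀ z : LocalRing L v, Ψ (R z, I z) = z := fun z => apply_re_im Ψ.toLinearEquiv.toAddEquiv z
  -- skewness entrywise: `σ (h j i) = −h i j`
  have hsk : ∀ i j : Fin 2, conjLocal L (IsCMField.complexConj L) v (h j i) = -h i j := fun i j => by
    have := congrFun (congrFun hh i) j
    rwa [Matrix.transpose_apply, Matrix.map_apply, Matrix.neg_apply] at this
  -- `−Ψ(a, b) = Ψ(−a, −b)`
  have hneg : ∀ a b : v.adicCompletion (Fp L), -Ψ (a, b) = Ψ (-a, -b) := fun a b => by rw [← Prod.neg_mk, map_neg]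
  -- diagonal entries are purely imaginary
  have hdiag : ∀ i : Fin 2, h i i = Ψ (0, I (h i i)) := fun i => by
    have h1 := hsk i i
    rw [← hcoord (h i i), conjLocal_quadraticLocalEquiv, hneg] at h1
    have h2 : R (h i i) = -R (h i i) := (Prod.ext_iff.1 (Ψ.injective h1)).1
    have h3 : R (h i i) = 0 := by
      have h4 : (2 : v.adicCompletion (Fp L)) * R (h i i) = 0 := by linear_combination h2
      exact (mul_eq_zero.1 h4).resolve_left two_ne_zero
    conv_lhs => rw [← hcoord (h i i), h3]
  -- the lower-left entry is `Ψ (−R h₀₁, I h₀₁)`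
  have h10 : h 1 0 = Ψ (-R (h 0 1), I (h 0 1)) := by
    have h1 := hsk 1 0
    rw [← hcoord (h 0 1), conjLocal_quadraticLocalEquiv] at h1
    rw [← neg_neg (h 1 0), ← h1, hneg, neg_neg]
  have h2 : ∀ b : v.adicCompletion (Fp L), ⅟(2 : v.adicCompletion (Fp L)) * (2 * b) = b := fun b => by
    rw [← mul_assoc, invOf_mul_self', one_mul]
  refine ⟨![-I (h 0 0), -I (h 1 1), -(2 * I (h 0 1)), -(2 * R (h 0 1))], Matrix.ext fun i j => ?_⟩
  have hi : i = 0 ∨ i = 1 := by fin_cases i <;> simp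
  have hj : j = 0 ∨ j = 1 := by fin_cases j <;> simp
  rcases hi with rfl | rfl <;> rcases hj with rfl | rfl
  · -- (0,0)
    conv_rhs => rw [hdiag 0]
    simp only [hMat, Matrix.of_apply, Matrix.cons_val', Matrix.cons_val_zero, Matrix.empty_val', Matrix.cons_val_fin_one, neg_neg]
    rfl
  · -- (0,1)
    conv_rhs => rw [← hcoord (h 0 1)]
    simp only [hMat, Matrix.of_apply, Matrix.cons_val', Matrix.cons_val_zero, Matrix.cons_val_one, Matrix.empty_val', Matrix.cons_val_fin_one,
      Matrix.cons_val, mul_neg, neg_neg, h2]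
    rfl
  · -- (1,0)
    rw [h10]
    simp only [hMat, Matrix.of_apply, Matrix.cons_val', Matrix.cons_val_zero, Matrix.cons_val_one, Matrix.empty_val', Matrix.cons_val_fin_one,
      Matrix.cons_val, mul_neg, neg_neg, h2]
    rfl
  · -- (1,1)
    conv_rhs => rw [hdiag 1]
    simp only [hMat, Matrix.of_apply, Matrix.cons_val', Matrix.cons_val_zero, Matrix.cons_val_one, Matrix.empty_val', Matrix.cons_val_fin_one,
      Matrix.cons_val, neg_neg]
    rfl

omit [Algebra.IsQuadraticExtension (Fp L) L] in
/-- for a `S₀`-skew `t`, the table `S₀ · t` is skew-hermitian (`S₀` real symmetric). [cite: Weil1964, n° 32] -/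
theorem conjTranspose_gramS_mul_of_skew {t : Matrix (Fin 2) (Fin 2) (LocalRing L v)}
    (ht : (t.map (conjLocal L (IsCMField.complexConj L) v))ᵀ * LocalSplitting.gramS (Fp L) L v 2 (gramR L e dV hdV dW hdW) +
      LocalSplitting.gramS (Fp L) L v 2 (gramR L e dV hdV dW hdW) * t = 0) :
    ((LocalSplitting.gramS (Fp L) L v 2 (gramR L e dV hdV dW hdW) * t).map (conjLocal L (IsCMField.complexConj L) v))ᵀ =
      -(LocalSplitting.gramS (Fp L) L v 2 (gramR L e dV hdV dW hdW) * t) := by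
  rw [Matrix.map_mul, Matrix.transpose_mul, gramS_map_conj (Fp L) L (IsCMField.complexConj L) v 2,
    gramS_transpose (Fp L) L v 2 (gramR_isSymm L e dV hdV dW hdW)]
  exact eq_neg_of_add_eq_zero_left ht

include hdV0 hdW0 in
/-- **every `S₀`-skew `t` is `t(η)`** (`t(η) = S₀⁻¹ h(η)`, `exists_hMat_eq` at `S₀ t`). [cite: Kudla1994, §3] [cite: Weil1964, n° 32] -/
theorem exists_tMat_eq {t : Matrix (Fin 2) (Fin 2) (LocalRing L v)}
    (ht : (t.map (conjLocal L (IsCMField.complexConj L) v))ᵀ * LocalSplitting.gramS (Fp L) L v 2 (gramR L e dV hdV dW hdW) +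
      LocalSplitting.gramS (Fp L) L v 2 (gramR L e dV hdV dW hdW) * t = 0) :
    ∃ η : Fin 4 → v.adicCompletion (Fp L), tMat L e dV hdV dW hdW v η = t := by
  obtain ⟨η, hη⟩ := exists_hMat_eq L v _ (conjTranspose_gramS_mul_of_skew L e dV hdV dW hdW v ht)
  refine ⟨η, ?_⟩
  rw [tMat, hη, ← Matrix.mul_assoc, Matrix.nonsing_inv_mul _ (isUnit_det_gramS_gramR L e dV hdV hdV0 dW hdW hdW0 v), Matrix.one_mul]

/-- **THE PINS EXHAUST `N_Δ(L⁺_v)`** (`n = 2`): every `u ∈ N_Δ(L⁺_v)` is `nΔ η` for some `η ∈ (L⁺_v)⁴` (`u = n(B(u))`, ★ `eq_nElem_of_mem_unipDeltaLocal`; `B(u) = t(η)`).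
[cite: Kudla1994, §3 Thm. 3.1] [cite: Weil1964, n° 32] -/
theorem exists_nDeltaLoc_eq_of_mem_unipDeltaLocal {u : UnitaryGroup.localPi L (IsCMField.complexConj L) (2 + 2) (hermD L e dV hdV dW hdW) v}
    (hu : u ∈ unipDeltaLocal (Fp L) L (IsCMField.complexConj L) v 2 (JD := hermD L e dV hdV dW hdW)) :
    ∃ η : Fin 4 → v.adicCompletion (Fp L), nDeltaLoc L e dV hdV dW hdW v hdV0 hdW0 η = u := by
  obtain ⟨η, hη⟩ := exists_tMat_eq L e dV hdV hdV0 dW hdW hdW0 v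
    (skew_blkB_of_mem_unipDeltaLocal (Fp L) L (IsCMField.complexConj L) v 2 (hermD_eq_map_gramD L e dV hdV dW hdW) hu)
  refine ⟨η, ?_⟩
  conv_rhs => rw [eq_nElem_of_mem_unipDeltaLocal (Fp L) L (IsCMField.complexConj L) v 2 (hermD_eq_map_gramD L e dV hdV dW hdW) hu]
  exact nElem_congr (Fp L) L (IsCMField.complexConj L) v 2 (hermD_eq_map_gramD L e dV hdV dW hdW) hη _ _

end Pins

/-! ## §5 The `D`-block of the Siegel Levi and the `hG` letter of ★ S-2c (b) -/

section LeviBlock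

variable (L : Type) [Field L] [NumberField L] [IsCMField L]
variable {N M n : ℕ} (e : Fin N × Fin M ≃ Fin n)
  (dV : Fin N → L) (hdV : ∀ i, IsCMField.complexConj L (dV i) = dV i)
  (dW : Fin M → L) (hdW : ∀ i, IsCMField.complexConj L (dW i) = dW i)
variable {M₂ M' n' : ℕ} (eW : Fin M × Fin M₂ ≃ Fin M') (e' : Fin N × Fin M' ≃ Fin n')
  (dV' : Fin M₂ → L) (hdV' : ∀ k, IsCMField.complexConj L (dV' k) = dV' k)
variable (v : HeightOneSpectrum (𝓞 (Fp L)))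

/-- `C(a) = 0` for `a ∈ M_Δ` (★ I-2 `mem_leviDeltaLoc_iff`). [cite: Kudla1994, §3] -/
theorem blkC_coe_leviDeltaLoc (a : ↥(leviDeltaLoc L e dV hdV dW hdW v)) :
    blkC (matA (Fp L) L (IsCMField.complexConj L) v n (a : UnitaryGroup.localPi L (IsCMField.complexConj L) (n + n) (hermD L e dV hdV dW hdW) v)) = 0 :=
  ((mem_leviDeltaLoc_iff L e dV hdV dW hdW v _).1 a.2).2

set_option maxHeartbeats 400000 in -- as ★ I-2 `leviBlkDHom` (the subgroup coercions of `M_Δ` over `L ⊗ L⁺_v` unfold slowly)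
/-- **`D(a)⁻¹ = D(a⁻¹)` on the Siegel Levi**: the `D`-block unit (★ I-0 `blkDGL`) is multiplicative on `M_Δ` (★ `blkDGL_mul`). [cite: Kudla1994, §3] -/
theorem val_inv_blkDGL_leviDeltaLoc (a : ↥(leviDeltaLoc L e dV hdV dW hdW v)) :
    ((blkDGL (Fp L) L (IsCMField.complexConj L) v n (a : UnitaryGroup.localPi L (IsCMField.complexConj L) (n + n) (hermD L e dV hdV dW hdW) v)
        (blkC_coe_leviDeltaLoc L e dV hdV dW hdW v a))⁻¹).val =
      blkD (matA (Fp L) L (IsCMField.complexConj L) v n ((a⁻¹ : ↥(leviDeltaLoc L e dV hdV dW hdW v)) : UnitaryGroup.localPi L (IsCMField.complexConj L) (n + n) (hermD L e dV hdV dW hdW) v)) := by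
  have hprod : ((a⁻¹ : ↥(leviDeltaLoc L e dV hdV dW hdW v)) : UnitaryGroup.localPi L (IsCMField.complexConj L) (n + n) (hermD L e dV hdV dW hdW) v) *
      (a : UnitaryGroup.localPi L (IsCMField.complexConj L) (n + n) (hermD L e dV hdV dW hdW) v) = 1 := by
    rw [← Subgroup.coe_mul, inv_mul_cancel, Subgroup.coe_one]
  have hC1 : blkC (matA (Fp L) L (IsCMField.complexConj L) v n
      (((a⁻¹ : ↥(leviDeltaLoc L e dV hdV dW hdW v)) : UnitaryGroup.localPi L (IsCMField.complexConj L) (n + n) (hermD L e dV hdV dW hdW) v) *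
        (a : UnitaryGroup.localPi L (IsCMField.complexConj L) (n + n) (hermD L e dV hdV dW hdW) v))) = 0 := by
    rw [hprod, matA_one, blkC_one]
  have h1 : blkDGL (Fp L) L (IsCMField.complexConj L) v n _ (blkC_coe_leviDeltaLoc L e dV hdV dW hdW v a⁻¹) *
      blkDGL (Fp L) L (IsCMField.complexConj L) v n _ (blkC_coe_leviDeltaLoc L e dV hdV dW hdW v a) = 1 := by
    rw [← blkDGL_mul (Fp L) L (IsCMField.complexConj L) v n _ _ _ _ hC1]
    apply Units.ext
    rw [val_blkDGL, Units.val_one, hprod, matA_one, blkD_one]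
  rw [inv_eq_of_mul_eq_one_left h1, val_blkDGL]

set_option maxHeartbeats 400000 in -- as ★ I-2 `val_leviBlkD`
/-- **THE `hG` LETTER**: `(D(a ⊗ 1))⁻¹ = reindex epsV (D(a)⁻¹ ⊗ₖ 1)` — the hypothesis of ★ S-2c (b) `krFrameTw_leviAct_inv_slice_mulVec` for `G := leviBlkDHom a` (★ I-2 `val_leviBlkD`).
[cite: Kudla1994, §3] [cite: KudlaRallis1994, §1] -/
theorem val_inv_leviBlkDHom (a : ↥(leviDeltaLoc L e dV hdV dW hdW v)) :
    (leviBlkDHom L e dV hdV dW hdW eW e' dV' hdV' v a)⁻¹.val =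
      Matrix.reindex (epsV e eW e') (epsV e eW e')
        (((blkDGL (Fp L) L (IsCMField.complexConj L) v n (a : UnitaryGroup.localPi L (IsCMField.complexConj L) (n + n) (hermD L e dV hdV dW hdW) v)
            (blkC_coe_leviDeltaLoc L e dV hdV dW hdW v a))⁻¹).val ⊗ₖ
          (1 : Matrix (Fin M₂) (Fin M₂) (LocalRing L v))) := by
  rw [← map_inv, leviBlkDHom_apply, val_leviBlkD, val_inv_blkDGL_leviDeltaLoc]

end LeviBlock

end Summit.HodgeConjecture.HodgeConjecture.Cruxes.HLiu418.K2LiuA7ValueSliceGeometry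

end
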